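import Literature.AlgebraicGeometry.HodgeTheory.BlochSemiregularSpreadGlobal
import Literature.AlgebraicGeometry.HodgeTheory.AlgebraicityLocusIUnionClosedProofs
import Literature.AlgebraicGeometry.HodgeTheory.IsoTransport
import Literature.AlgebraicGeometry.HodgeTheory.HodgeTypeConjugation
import HarnessLib

/-!
# Venture HSemireg — the transfer chain: a semiregular representative at ONE point of a component of the
# locus of Hodge classes makes the class algebraic on the WHOLE component (assembled from the tree's facts)

HONEST FRAMING. Interface/assembly file of the computation cell `pub-hsemireg` (theory seat 3). NOTHING is
claimed about any particular variety, and nothing here says that the Hodge conjecture (or its CM case) is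
proved: every theorem carries its hypotheses by name. What the file does is to COMPOSE, once, the printed
transfer chain

  «a Hodge class `α₀` on ONE fibre `𝒴_{t₀}` (in practice a CM point, where explicit cycles are available) is
   the class of an explicit local complete intersection `Z₀` which is SEMIREGULAR (Bloch 1972)
   ⟹ the flat transport of `α₀` is algebraic on EVERY fibre of the component of the locus of Hodge classes
   through `(t₀, α₀)`»

as ONE kernel-checked theorem on the tree's REAL carriers, modulo exactly the named inputs listed below, so
that a certificate produced by the cell's engines (`Certificate.lean`: `IsBlochSemiregular` from an exact
matrix) plugs into the hypothesis `hsr` and the output reads «algebraic on the component».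

## The carriers (all pre-existing; nothing is re-declared)

* `HodgeTheory.FiberClass g k`, `HodgeTheory.locusOfHodgeClasses g n p`,
  `HodgeTheory.HodgeLocusComponent g n p` with `C.carrier` (`HodgeLocus.lean`): the locus of Hodge classes
  of a family `g : 𝒴 ⟶ M` — pairs `(t, α)`, `α ∈ H²ᵖ(𝒴_t(ℂ); ℂ)` rational of type `(p,p)` — with the
  étalé topology, and its connected components (Cattani–Deligne–Kaplan 1995 §1; Voisin 2007 §1;
  Charles–Schnell 2014 Def. 11.3.9).
* `HodgeTheory.algebraicClasses X p = Nᵖ H²ᵖ(X(ℂ); ℂ)` (`AlgebraicClasses.lean`), `classesSupportedOn`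
  (`ClassesSupportedOn.lean`), `IsRegularImmersionOfCodim`, `IsBlochSemiregular`
  (`BlochSemiregularSpread.lean`, `BlochSemiregularityMapReal.lean`), `Motives.IsSmoothProjectiveFamily`,
  `Motives.fiberOver`, `Motives.fiberι` (`Motives/FamiliesVHS.lean`), `IsQuasiProjectiveOver`.

## The inputs, BY NAME (the «cited Props»)

* `BlochSemiregularSpread n p` — HYPOTHESIS `hB`. Bloch 1972, Thm. (7.4) with (7.3)/(7.1) = Buchweitz–Flenner
  2003, Thm. 5.2 at `I = {p}`, class-level, LOCAL form («`α_p(s)` is algebraic for all `s ∈ S` near `0`»),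
  refereed named fact of the tree (`BlochSemiregularSpread.lean`). The algebraisation steps of the printed
  proofs live INSIDE this fact (Bloch p. 64–65: formal lifting over `Spec ℂ[[t]]` by (6.10), an `S̄`-point of
  `Hilb(X/S)` by Grothendieck's existence theorem — diagram (7.2) —, a convergent lift by «a theorem of Artin
  [1]»; BF p. 27: «a versal deformation and Artin approximation»; algebraicity of the fibres of the analytic
  family by GAGA/Chow) — see `theory/TH3-ALGEBRAISATION.md` of the cell for the page/line audit.
* `charlesSchnell_algebraicityLocus_iUnion_closed` — DISCHARGED in the tree
  (`charlesSchnell_algebraicityLocus_iUnion_closed_holds`, from Mumford's curve lemma and the tree's inputs;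
  Bloch p. 65 L19–22 «A simple argument using the Hilbert scheme shows `T = {s ∈ S | z_s is algebraic}` is
  contained in a countable union of closed subvarieties of `S`»), so it is NOT a hypothesis here: the global
  form `BlochSemiregularSpread.forall_mem_algebraicClasses` (Bloch (7.4) «for all `s ∈ S`»,
  `BlochSemiregularSpreadGlobal.lean`) is used with it.
* `SweepsClasses f W A` — HYPOTHESIS `hsweep` (defined here): the component (more generally a set `A` of
  fibre classes of `g`) is SWEPT by a smooth projective family `f : 𝒳 ⟶ T` over a smooth IRREDUCIBLE
  quasi-projective `T` carrying a GLOBAL class `W` that is fibrewise rational of type `(p,p)`: every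
  `(t, α) ∈ A` is `(e⁻¹)^*`-related to some `W|_{𝒳_u}` by an isomorphism of fibres `e : 𝒳_u ≅ 𝒴_t`. This is
  where the ALGEBRAICITY of the component enters: Cattani–Deligne–Kaplan 1995, Thm. 1.1 / Cor. 1.2 (a
  component of the locus of Hodge classes is an algebraic variety, finite over the base), Hironaka
  (resolution: the sweeping base may be taken smooth — the semiregular fibre and its class are unchanged
  under pull-back, so NO smoothness of the Hodge locus at the special point is needed), and, for the
  universal family over `𝒜_{g,N}`, Carlson–Müller-Stach–Peters 2017, Prop. 17.1.2 (the component through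
  `o` is the `MT(o)`-orbit, a Mumford–Tate subdomain: irreducible); the GLOBAL class `W` on the chart exists by
  the global invariant cycle theorem (Deligne, *Hodge II*, Thm. 4.1.1 = Charles–Schnell Thm. 11.3.4; tree named
  fact `deligne_globalInvariantCycles`: the tautological class is a continuous global section of the étalé space,
  i.e. monodromy-invariant, hence the restriction of a class of the total space). It is kept as an HYPOTHESIS (theory seat
  2 supplies the `𝒜_g` instance as a named Prop); for a general family a connected component may be
  REDUCIBLE, semiregularity does not propagate from one irreducible component to the next, and then the
  theorem applies to the irreducible component(s) through the special point — which is why the chart form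
  `forall_mem_algebraicClasses_of_sweepsClasses` (conclusion on the swept set) is the primary statement.

What is NOT an input: CM-ness of the special point, the Hodge conjecture for CM abelian varieties, density of
CM points (André–Oort direction), finiteness of Mumford–Tate types. The deduction goes FROM one point with an
exhibited representative TO every member of its component; «HC at the CM point» is consumed as the CLASS
IDENTITY `hsupp` (the Hodge class is supported on the exhibited `Z₀`), not as a hypothesis named `HC_CM`.

## Theorems

* `forall_mem_algebraicClasses_of_sweepsClasses` — chart form: `hB` ∧ (f, W) sweeps `A` ∋ x₀ ∧ semiregular
  integral lci representative of `x₀.cls` ⟹ every class in `A` is algebraic.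
* `forall_mem_algebraicClasses_of_sweepsClasses_of_smul_add` — Bloch's Remark (7.5) form: the representative
  may carry `a • x₀.cls + b • L₀` with `a ≠ 0` and `L` a global class of the chart algebraic on every fibre
  (e.g. a power of the polarisation), the shape `q·hⁿ + w` of the cell's Weil-type representatives.
* `hc_on_component_of_semiregular_at_CM_point` (+ `…_of_smul_add`) — the component form asked for by the
  cell's coordinator: `A = C.carrier` for `C : HodgeLocusComponent g n p`.

References: [Bloch1972Semiregularity] Invent. Math. 17 (1972), (7.1)–(7.5), pp. 64–65;
[BuchweitzFlenner2003] Compositio Math. 137 (2003), Thm. 5.1/5.2 and proof p. 179;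
[CattaniDeligneKaplan1995JAMS] JAMS 8 (1995), Thm. 1.1, Cor. 1.2; [CharlesSchnell2014Notes] Prop. 11.3.11,
Thm. 11.3.12; [CarlsonMullerStachPeters2017] Prop. 17.1.2, Cor. 17.1.5; [Hironaka1964] Ann. Math. 79, Main
Thm. I; [Voisin2007HodgeLoci] Compositio 143, §1.
-/

noncomputable section

open CategoryTheory AlgebraicGeometry Set
open Literature.AlgebraicGeometry.Motives Literature.AlgebraicGeometry.HodgeTheory

namespace Summit.Ventures.HSemireg

local notation3 (prettyPrint := false) "Res[" f ", " s ", " k ", " A "]" =>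
  complexBetti.map (Literature.AlgebraicGeometry.Motives.fiberι f s) k A

/-! ## Sweeping a set of fibre classes by a chart carrying a global class -/

section Sweep

variable {𝒴 M : SchemeOver ℂ} (g : 𝒴 ⟶ M) {𝒳 T : SchemeOver ℂ} (f : 𝒳 ⟶ T) {k : ℕ}

/-- The family `f : 𝒳 ⟶ T` with the global class `W ∈ Hᵏ(𝒳(ℂ); ℂ)` **sweeps** the set `A` of fibre classes
of `g : 𝒴 ⟶ M`: every `(t, α) ∈ A` is, up to an isomorphism of fibres `e : 𝒳_u ≅ 𝒴_t` over `ℂ`, a value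
of the global section `u ↦ W|_{𝒳_u}` — `e^* α = W|_{𝒳_u}`. For `A` a component of the locus of Hodge
classes this is the algebraic chart of Cattani–Deligne–Kaplan (the component is an algebraic variety `T₁`
finite over `M`; pull the family back to a resolution `T → T₁` and take for `W` the tautological class,
a flat global section by construction). [cite: CattaniDeligneKaplan1995JAMS, Thm. 1.1 and Cor. 1.2]
[cite: CharlesSchnell2014Notes, Thm. 11.3.12] -/
def SweepsClasses (W : complexBetti 𝒳 k) (A : Set (FiberClass g k)) : Prop :=
  ∀ x ∈ A, ∃ (u : ComplexPoints T) (e : fiberOver f u ≅ fiberOver g x.pt),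
    complexBetti.map e.hom k x.cls = Res[f, u, k, W]

variable {g f}

/-- Sweeping is monotone in the swept set. [folklore] -/
theorem SweepsClasses.mono {W : complexBetti 𝒳 k} {A B : Set (FiberClass g k)} (h : SweepsClasses g f W B)
    (hAB : A ⊆ B) : SweepsClasses g f W A :=
  fun x hx => h x (hAB hx)

/-- If `(f, W)` sweeps `A` and `W` is algebraic on EVERY fibre of `f`, then every class in `A` is algebraic
(algebraic classes transport along isomorphisms of `ℂ`-schemes: `mem_algebraicClasses_map_iff_of_iso`).
[cite: GrothendieckTopology1969, §1] -/
theorem SweepsClasses.mem_algebraicClasses {p : ℕ} {W : complexBetti 𝒳 (2 * p)}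
    {A : Set (FiberClass g (2 * p))} (h : SweepsClasses g f W A)
    (hW : ∀ u : ComplexPoints T, Res[f, u, 2 * p, W] ∈ algebraicClasses (fiberOver f u) p)
    {x : FiberClass g (2 * p)} (hx : x ∈ A) : x.cls ∈ algebraicClasses (fiberOver g x.pt) p := by
  obtain ⟨u, e, he⟩ := h x hx
  exact (mem_algebraicClasses_map_iff_of_iso e).1 (he ▸ hW u)

end Sweep

/-! ## The chart form of the transfer -/

section Chart

variable {𝒴 M : SchemeOver ℂ} {g : 𝒴 ⟶ M} {𝒳 T : SchemeOver ℂ} {f : 𝒳 ⟶ T} {n p : ℕ}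

/-- **Transfer along a chart (Bloch 1972 (7.4) global ∘ CDK chart).** Let `f : 𝒳 ⟶ T` be a smooth projective
family of relative dimension `n`, `𝒳` and `T` quasi-projective, `T` smooth and irreducible, and
`W ∈ H²ᵖ(𝒳(ℂ); ℂ)` a global class whose fibre restrictions are rational of type `(p,p)` («`z` a horizontal
section», Bloch; «`(α_p)` horizontal», BF) such that `(f, W)` sweeps a set `A` of fibre classes of
`g : 𝒴 ⟶ M`. Suppose ONE class `x₀ = (t₀, α₀) ∈ A` is supported on an integral local complete intersection
`i : Z ↪ 𝒴_{t₀}` of codimension `p` which is Bloch-semiregular («`z₀` is algebraic, representing a local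
complete intersection `Z₀ ⊂ X₀` which is semi-regular in `X₀`»). Then, granted the named fact
`BlochSemiregularSpread n p`, EVERY class in `A` is algebraic. Proof: `x₀` is `e₀^*`-related to `W|_{𝒳_{u₀}}`;
`BlochSemiregularSpread.forall_mem_algebraicClasses` (with the tree's proof of the algebraicity-locus fact)
makes `W` algebraic on every fibre of `f`; sweep. [cite: Bloch1972Semiregularity, Thm. (7.4) and its proof, p. 65]
[cite: BuchweitzFlenner2003, Thm. 5.2] [cite: CattaniDeligneKaplan1995JAMS, Thm. 1.1 and Cor. 1.2] -/
theorem forall_mem_algebraicClasses_of_sweepsClasses (hB : BlochSemiregularSpread n p)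
    (hf : IsSmoothProjectiveFamily f n) (h𝒳 : IsQuasiProjectiveOver 𝒳) (hT : IsQuasiProjectiveOver T)
    (hTs : _root_.AlgebraicGeometry.Smooth T.hom) [IrreducibleSpace T.left]
    {W : complexBetti 𝒳 (2 * p)}
    (hW : ∀ u : ComplexPoints T, IsRationalClass (Res[f, u, 2 * p, W]) ∧
      IsOfHodgeType n (fiberOver f u) (2 * p) p p (Res[f, u, 2 * p, W]))
    {A : Set (FiberClass g (2 * p))} (hsweep : SweepsClasses g f W A)
    {x₀ : FiberClass g (2 * p)} (hx₀ : x₀ ∈ A)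
    {Z : Scheme.{0}} (i : Z ⟶ (fiberOver g x₀.pt).left) (hi : IsClosedImmersion i)
    (hreg : IsRegularImmersionOfCodim i p) (hZ : AlgebraicGeometry.IsIntegral Z)
    (hcodim : ∀ z ∈ Set.range i.base, (p : ℕ∞) ≤ Order.coheight z) (hsr : IsBlochSemiregular i n p)
    (hsupp : x₀.cls ∈ classesSupportedOn (fiberOver g x₀.pt) (Set.range i.base) (2 * p)) :
    ∀ x ∈ A, x.cls ∈ algebraicClasses (fiberOver g x.pt) p := by
  obtain ⟨u₀, e₀, he₀⟩ := hsweep x₀ hx₀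
  have hWx : complexBetti.map e₀.symm.hom (2 * p) (Res[f, u₀, 2 * p, W]) = x₀.cls := by
    rw [← he₀, Iso.symm_hom, e₀.complexBetti_map_inv_map_hom]
  have hall : ∀ u : ComplexPoints T, Res[f, u, 2 * p, W] ∈ algebraicClasses (fiberOver f u) p :=
    hB.forall_mem_algebraicClasses charlesSchnell_algebraicityLocus_iUnion_closed_holds
      (fiberOver g x₀.pt) Z i x₀.cls f u₀ e₀.symm W hi hreg hZ hcodim hsr hsupp hf h𝒳 hT hTs hW hWx
  exact fun x hx => hsweep.mem_algebraicClasses hall hx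

/-- **Transfer along a chart, Bloch's Remark (7.5) form** («the hypothesis on `z₀` in (7.4) can be weakened to
read: there exist integers `a, b`, `a ≠ 0`, such that `a z₀ + b l₀ᵖ` is the class of a subscheme `Z₀ ⊂ X₀`
which is semi-regular and a local complete intersection»). Same as
`forall_mem_algebraicClasses_of_sweepsClasses`, but the semiregular integral lci `i : Z ↪ 𝒳_{u₀}` now
supports `a • W|_{𝒳_{u₀}} + b • L|_{𝒳_{u₀}}` with `a ≠ 0`, where `L ∈ H²ᵖ(𝒳(ℂ); ℂ)` is a second global class
of the chart which is fibrewise rational of type `(p,p)` AND algebraic on every fibre (a power of the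
relative polarisation; for the cell: `W ↦ w`, `L ↦ hⁿ`, `a • W + b • L ↦ q·hⁿ + w`). Then every class of
the swept set `A` is algebraic: `a • W + b • L` is algebraic on every fibre by the previous argument, hence
so is `W = a⁻¹ • ((a • W + b • L) - b • L)` (algebraic classes form a `ℂ`-subspace); sweep.
[cite: Bloch1972Semiregularity, Remark (7.5), p. 65] [cite: BuchweitzFlenner2003, Thm. 5.2] -/
theorem forall_mem_algebraicClasses_of_sweepsClasses_of_smul_add (hB : BlochSemiregularSpread n p)
    (hf : IsSmoothProjectiveFamily f n) (h𝒳 : IsQuasiProjectiveOver 𝒳) (hT : IsQuasiProjectiveOver T)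
    (hTs : _root_.AlgebraicGeometry.Smooth T.hom) [IrreducibleSpace T.left]
    {W L : complexBetti 𝒳 (2 * p)}
    (hW : ∀ u : ComplexPoints T, IsRationalClass (Res[f, u, 2 * p, W]) ∧
      IsOfHodgeType n (fiberOver f u) (2 * p) p p (Res[f, u, 2 * p, W]))
    (hL : ∀ u : ComplexPoints T, IsRationalClass (Res[f, u, 2 * p, L]) ∧
      IsOfHodgeType n (fiberOver f u) (2 * p) p p (Res[f, u, 2 * p, L]))
    (hLalg : ∀ u : ComplexPoints T, Res[f, u, 2 * p, L] ∈ algebraicClasses (fiberOver f u) p)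
    {A : Set (FiberClass g (2 * p))} (hsweep : SweepsClasses g f W A)
    (u₀ : ComplexPoints T) (a b : ℚ) (ha : a ≠ 0)
    {Z : Scheme.{0}} (i : Z ⟶ (fiberOver f u₀).left) (hi : IsClosedImmersion i)
    (hreg : IsRegularImmersionOfCodim i p) (hZ : AlgebraicGeometry.IsIntegral Z)
    (hcodim : ∀ z ∈ Set.range i.base, (p : ℕ∞) ≤ Order.coheight z) (hsr : IsBlochSemiregular i n p)
    (hsupp : (a : ℂ) • Res[f, u₀, 2 * p, W] + (b : ℂ) • Res[f, u₀, 2 * p, L] ∈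
      classesSupportedOn (fiberOver f u₀) (Set.range i.base) (2 * p)) :
    ∀ x ∈ A, x.cls ∈ algebraicClasses (fiberOver g x.pt) p := by
  -- the combined global class `a • W + b • L` («`a z + b lᵖ`») and its fibre restrictions
  have hVres : ∀ u : ComplexPoints T, Res[f, u, 2 * p, (a : ℂ) • W + (b : ℂ) • L] =
      (a : ℂ) • Res[f, u, 2 * p, W] + (b : ℂ) • Res[f, u, 2 * p, L] := fun u => by
    simp only [map_add, map_smul]
  have hVhodge : ∀ u : ComplexPoints T, IsRationalClass (Res[f, u, 2 * p, (a : ℂ) • W + (b : ℂ) • L]) ∧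
      IsOfHodgeType n (fiberOver f u) (2 * p) p p (Res[f, u, 2 * p, (a : ℂ) • W + (b : ℂ) • L]) :=
    fun u => by
    rw [hVres u]
    exact ⟨((hW u).1.smul a).add ((hL u).1.smul b),
      ((hW u).2.smul (a : ℂ)).add (hf.isSmoothProjective u) ((hL u).2.smul (b : ℂ))⟩
  have hVx : complexBetti.map (Iso.refl (fiberOver f u₀)).hom (2 * p)
      (Res[f, u₀, 2 * p, (a : ℂ) • W + (b : ℂ) • L]) =
      (a : ℂ) • Res[f, u₀, 2 * p, W] + (b : ℂ) • Res[f, u₀, 2 * p, L] := by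
    rw [Iso.refl_hom, complexBetti.map_id]; exact hVres u₀
  have hall : ∀ u : ComplexPoints T,
      Res[f, u, 2 * p, (a : ℂ) • W + (b : ℂ) • L] ∈ algebraicClasses (fiberOver f u) p :=
    hB.forall_mem_algebraicClasses charlesSchnell_algebraicityLocus_iUnion_closed_holds
      (fiberOver f u₀) Z i _ f u₀ (Iso.refl _) ((a : ℂ) • W + (b : ℂ) • L) hi hreg hZ hcodim hsr hsupp hf
      h𝒳 hT hTs hVhodge hVx
  have ha' : (a : ℂ) ≠ 0 := by exact_mod_cast ha
  have hWalg : ∀ u : ComplexPoints T, Res[f, u, 2 * p, W] ∈ algebraicClasses (fiberOver f u) p := by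
    intro u
    have h1 : (a : ℂ) • Res[f, u, 2 * p, W] ∈ algebraicClasses (fiberOver f u) p := by
      have := Submodule.sub_mem _ (hall u) (Submodule.smul_mem _ (b : ℂ) (hLalg u))
      rwa [hVres u, add_sub_cancel_right] at this
    have h2 := Submodule.smul_mem _ (a : ℂ)⁻¹ h1
    rwa [smul_smul, inv_mul_cancel₀ ha', one_smul] at h2
  exact fun x hx => hsweep.mem_algebraicClasses hWalg hx

end Chart

/-! ## The component form: «HC on the Hodge-locus component through the semiregular (CM) point» -/

section Component

variable {𝒴 M : SchemeOver ℂ} {g : 𝒴 ⟶ M} {𝒳 T : SchemeOver ℂ} {f : 𝒳 ⟶ T} {n p : ℕ}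

/-- **The transfer chain of the cell `pub-hsemireg`, as ONE theorem** («HC at a semiregular point ⟹ HC on that
component of the Hodge locus»). DATA: an ambient family `g : 𝒴 ⟶ M` of complex varieties (e.g. a universal
polarised family of abelian varieties) and a component `C` of its locus of Hodge classes in degree `2p`
(`HodgeLocusComponent g n p`: a connected component of the space of pairs `(t, α)`, `α ∈ H²ᵖ(𝒴_t(ℂ); ℂ)`
rational of type `(p,p)`, in the étalé topology of `R²ᵖg_*ℂ`); a point `x₀ = (t₀, α₀) ∈ C` — in the cell's use
a CM point, which is where explicit representatives exist, but CM-ness is NOT used by the deduction —; an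
integral local complete intersection `i : Z ↪ 𝒴_{t₀}` of codimension `p` SUPPORTING `α₀` (the class
identity furnished at the special point; purity makes `α₀ = μ·cl(Z)`) which is BLOCH-SEMIREGULAR
(`IsBlochSemiregular i n p`: surjectivity of `H^{n-p-1}(Ω^{n-p+1}) → H^{n-p-1}(Z, 𝒩^∨ ⊗ ω_Z)`, i.e. injectivity
of Bloch's `π`; the cell certifies it by an exact right-inverse matrix, `Certificate.lean`). INPUTS BY NAME:
`hB : BlochSemiregularSpread n p` (Bloch 1972 (7.4) = BF 2003 Thm. 5.2, `I = {p}`, containing the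
formal-to-convergent algebraisation: Grothendieck existence for `Hilb`, Artin's theorem, GAGA), the tree's
PROOF of `charlesSchnell_algebraicityLocus_iUnion_closed` (Bloch's «simple argument using the Hilbert
scheme», p. 65), and `hsweep : SweepsClasses g f W C.carrier` for a smooth projective chart `f : 𝒳 ⟶ T`
(`T` smooth irreducible quasi-projective) with a fibrewise rational `(p,p)` global class `W` — the
algebraicity and irreducibility of the component (Cattani–Deligne–Kaplan 1995 Thm. 1.1/Cor. 1.2, Hironaka;
for `𝒜_g`: the component is a Mumford–Tate subdomain orbit, Carlson–Müller-Stach–Peters Prop. 17.1.2).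
CONCLUSION: for EVERY `(t, α) ∈ C`, `α ∈ algebraicClasses (𝒴_t) p` — the Hodge conjecture holds for every
class of the component. NOT inputs: HC for CM abelian varieties, CM density / André–Oort, finiteness of
Mumford–Tate types (`theory/TH3-MT-FINITENESS.md`: false as naively stated, and not needed per component).
[cite: Bloch1972Semiregularity, Thm. (7.4), its proof and Remark (7.5), p. 65]
[cite: BuchweitzFlenner2003, Thm. 5.2, p. 175 and proof p. 179]
[cite: CattaniDeligneKaplan1995JAMS, Thm. 1.1 and Cor. 1.2]
[cite: CarlsonMullerStachPeters2017, Prop. 17.1.2 and Cor. 17.1.5] -/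
theorem hc_on_component_of_semiregular_at_CM_point (hB : BlochSemiregularSpread n p)
    (C : HodgeLocusComponent g n p)
    (hf : IsSmoothProjectiveFamily f n) (h𝒳 : IsQuasiProjectiveOver 𝒳) (hT : IsQuasiProjectiveOver T)
    (hTs : _root_.AlgebraicGeometry.Smooth T.hom) [IrreducibleSpace T.left]
    {W : complexBetti 𝒳 (2 * p)}
    (hW : ∀ u : ComplexPoints T, IsRationalClass (Res[f, u, 2 * p, W]) ∧
      IsOfHodgeType n (fiberOver f u) (2 * p) p p (Res[f, u, 2 * p, W]))
    (hsweep : SweepsClasses g f W C.carrier)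
    {x₀ : FiberClass g (2 * p)} (hx₀ : x₀ ∈ C.carrier)
    {Z : Scheme.{0}} (i : Z ⟶ (fiberOver g x₀.pt).left) (hi : IsClosedImmersion i)
    (hreg : IsRegularImmersionOfCodim i p) (hZ : AlgebraicGeometry.IsIntegral Z)
    (hcodim : ∀ z ∈ Set.range i.base, (p : ℕ∞) ≤ Order.coheight z) (hsr : IsBlochSemiregular i n p)
    (hsupp : x₀.cls ∈ classesSupportedOn (fiberOver g x₀.pt) (Set.range i.base) (2 * p)) :
    ∀ x ∈ C.carrier, x.cls ∈ algebraicClasses (fiberOver g x.pt) p :=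
  forall_mem_algebraicClasses_of_sweepsClasses hB hf h𝒳 hT hTs hW hsweep hx₀ i hi hreg hZ hcodim hsr hsupp

/-- **The transfer chain, Bloch's Remark (7.5) form** — the representative may carry `a·α + b·λ`, `a ≠ 0`, with
`λ` a class algebraic along the whole chart (for the cell: `q·hⁿ + w` with `h` the polarisation of the
Weil-type component, `w` the Weil class): under the chart `(f, W)` sweeping the component `C`, a second
global class `L` of the chart, fibrewise rational `(p,p)` and fibrewise algebraic, a point `u₀` of the
chart and an integral Bloch-semiregular local complete intersection `i : Z ↪ 𝒳_{u₀}` of codimension `p`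
supporting `a • W|_{𝒳_{u₀}} + b • L|_{𝒳_{u₀}}`, every class of the component is algebraic.
[cite: Bloch1972Semiregularity, Remark (7.5), p. 65] [cite: BuchweitzFlenner2003, Thm. 5.2]
[cite: CattaniDeligneKaplan1995JAMS, Thm. 1.1 and Cor. 1.2] -/
theorem hc_on_component_of_semiregular_at_CM_point_of_smul_add (hB : BlochSemiregularSpread n p)
    (C : HodgeLocusComponent g n p)
    (hf : IsSmoothProjectiveFamily f n) (h𝒳 : IsQuasiProjectiveOver 𝒳) (hT : IsQuasiProjectiveOver T)
    (hTs : _root_.AlgebraicGeometry.Smooth T.hom) [IrreducibleSpace T.left]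
    {W L : complexBetti 𝒳 (2 * p)}
    (hW : ∀ u : ComplexPoints T, IsRationalClass (Res[f, u, 2 * p, W]) ∧
      IsOfHodgeType n (fiberOver f u) (2 * p) p p (Res[f, u, 2 * p, W]))
    (hL : ∀ u : ComplexPoints T, IsRationalClass (Res[f, u, 2 * p, L]) ∧
      IsOfHodgeType n (fiberOver f u) (2 * p) p p (Res[f, u, 2 * p, L]))
    (hLalg : ∀ u : ComplexPoints T, Res[f, u, 2 * p, L] ∈ algebraicClasses (fiberOver f u) p)
    (hsweep : SweepsClasses g f W C.carrier)
    (u₀ : ComplexPoints T) (a b : ℚ) (ha : a ≠ 0)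
    {Z : Scheme.{0}} (i : Z ⟶ (fiberOver f u₀).left) (hi : IsClosedImmersion i)
    (hreg : IsRegularImmersionOfCodim i p) (hZ : AlgebraicGeometry.IsIntegral Z)
    (hcodim : ∀ z ∈ Set.range i.base, (p : ℕ∞) ≤ Order.coheight z) (hsr : IsBlochSemiregular i n p)
    (hsupp : (a : ℂ) • Res[f, u₀, 2 * p, W] + (b : ℂ) • Res[f, u₀, 2 * p, L] ∈
      classesSupportedOn (fiberOver f u₀) (Set.range i.base) (2 * p)) :
    ∀ x ∈ C.carrier, x.cls ∈ algebraicClasses (fiberOver g x.pt) p :=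
  forall_mem_algebraicClasses_of_sweepsClasses_of_smul_add hB hf h𝒳 hT hTs hW hL hLalg hsweep u₀ a b ha
    i hi hreg hZ hcodim hsr hsupp

end Component

end Summit.Ventures.HSemireg

end
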